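import Mathlib.Analysis.InnerProductSpace.TwoDim
import Mathlib.Analysis.InnerProductSpace.Calculus
import Mathlib.Analysis.SpecialFunctions.Sqrt
import Mathlib.Analysis.Calculus.Deriv.Add
import Mathlib.Analysis.Calculus.Deriv.Mul
import Mathlib.Analysis.Calculus.Deriv.Inv
import Mathlib.Analysis.Calculus.Deriv.Comp
import Mathlib.Analysis.Calculus.Deriv.Prod
import Mathlib.Analysis.Calculus.FDeriv.Prod
import HarnessLib

/-!
# The area-preserving tubular map of a plane curve (Alberti–Crippa–Mazzucato 2019, Lemma 23)

Topic `Literature/Analysis/FluidPDE` (the geometric toolbox of the Alberti–Crippa–Mazzucato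
mixing construction, JAMS 32 (2019), §7). For a regular plane curve `γ` parametrised with
constant speed `|γ̇| = ℓ`, unit normal `η = ℓ⁻¹ J γ̇` (`J` the rotation by `+π/2`) and signed
curvature `κ` (`γ̈ = ℓ² κ η`, i.e. `κ = ω(γ̇, γ̈)/ℓ³` with `ω` the area form), ACM replace the
usual tubular parametrisation `(s, d) ↦ γ(s) + d η(s)` (Jacobian `ℓ(1 - κ d)`) by
`Φ(s, y) := γ(s) + α(s, y/ℓ) η(s)`, `α(s, y') := 2y' / (1 + √(1 - 2 y' κ(s)))`
(ACM (7.4)), and state (Lemma 23): *`Φ` is an area-preserving diffeomorphism*, "the fact that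
`Φ` is area-preserving, that is, `JΦ = 1` everywhere, can be verified by a direct computation".
This file carries out that computation:

* `acmAlpha k y' = 2y'/(1 + √(1 - 2y'k))` and its two algebraic identities on the domain
  `1 - 2y'k > 0`: `α - k α²/2 = y'` (`acmAlpha_sub_half_mul_sq`: `α` is the inverse of the
  area coordinate `d ↦ d - κd²/2` of the usual tubular map) and `1 - k α = √(1 - 2y'k)`
  (`one_sub_mul_acmAlpha`), whence `∂_{y'} α = (1 - kα)⁻¹` (`hasDerivAt_acmAlpha`);
* `areaForm_fderiv_tubularMap_eq_one` — **ACM Lemma 23, the Jacobian identity**: at every point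
  `(s, y)` with `1 - 2(y/ℓ)κ(s) > 0`, the map `Φ` is differentiable and its derivative `L`
  satisfies `ω(L(1,0), L(0,1)) = 1`. In the frame `(τ, η)`:
  `∂ₛΦ = γ̇ + (∂ₛα) η + α η̇`, `∂_yΦ = ℓ⁻¹ (∂_{y'}α) η`, and `ω(γ̇, η) = ℓ`, `ω(η̇, η) = -ℓκ`, so
  `ω(∂ₛΦ, ∂_yΦ) = (1 - κα) ∂_{y'}α = 1`.

Only the pointwise identity is formalised (the statement that `Φ` is a `C^{k-2}`
diffeomorphism onto a tubular neighbourhood, and the containments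
`B(Γ, r/(2ℓ)) ⊆ Φ(ℝ × (-r,r)) ⊆ B(Γ, 2r/ℓ)` of Lemma 23, are not). The setting is any oriented
two-dimensional real inner product space (Mathlib `Orientation.areaForm`,
`Orientation.rightAngleRotation`).

## References

* G. Alberti, G. Crippa, A. L. Mazzucato, *Exponential self-similar mixing by incompressible
  flows*, J. Amer. Math. Soc. 32 (2019), 445–490, Lemma 23 and (7.4) (arXiv:1605.02090, §7).
-/

noncomputable section

open Module

namespace Literature.Analysis.FluidPDE

namespace AlbertiCrippaMazzucato

/-! ## The area coordinate `α` -/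

/-- ACM's normal coordinate `α(k, y') = 2y' / (1 + √(1 - 2 y' k))` (ACM 2019, (7.4), with
`k = κ(s)` the curvature at the foot point): the solution of `α - k α²/2 = y'` that is regular
at `k = 0` (where `α = y'`). Meaningful on `1 - 2y'k > 0`; elsewhere `Real.sqrt` returns the
junk value `0` and `α = 2y'`. [cite: AlbertiCrippaMazzucato2019, Lemma 23, (7.4)] -/
def acmAlpha (k y : ℝ) : ℝ := 2 * y / (1 + Real.sqrt (1 - 2 * y * k))

/-- The denominator `1 + √(1 - 2y'k)` is positive. [folklore] -/
theorem one_add_sqrt_pos (k y : ℝ) : 0 < 1 + Real.sqrt (1 - 2 * y * k) := by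
  positivity

/-- The defining relation of `α` cleared of denominators: `α (1 + √(1 - 2y'k)) = 2y'`.
[folklore] -/
theorem acmAlpha_mul_one_add_sqrt (k y : ℝ) :
    acmAlpha k y * (1 + Real.sqrt (1 - 2 * y * k)) = 2 * y := by
  unfold acmAlpha
  field_simp [(one_add_sqrt_pos k y).ne']

/-- **`α` inverts the area coordinate of the tubular map**: `α - k α²/2 = y'` on
`1 - 2y'k > 0` (with `q = √(1 - 2y'k)`: `α (1 + q) = 2y'` and `q² = 1 - 2y'k`).
[cite: AlbertiCrippaMazzucato2019, Lemma 23] -/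
theorem acmAlpha_sub_half_mul_sq {k y : ℝ} (h : 0 < 1 - 2 * y * k) :
    acmAlpha k y - k * acmAlpha k y ^ 2 / 2 = y := by
  set q := Real.sqrt (1 - 2 * y * k) with hq
  have hq2 : q ^ 2 = 1 - 2 * y * k := Real.sq_sqrt h.le
  have hpos : 0 < 1 + q := one_add_sqrt_pos k y
  have ha : acmAlpha k y * (1 + q) = 2 * y := acmAlpha_mul_one_add_sqrt k y
  have key : (acmAlpha k y - k * acmAlpha k y ^ 2 / 2) * (1 + q) ^ 2 = y * (1 + q) ^ 2 := by
    have e1 : (acmAlpha k y - k * acmAlpha k y ^ 2 / 2) * (1 + q) ^ 2 =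
        (acmAlpha k y * (1 + q)) * (1 + q) - k / 2 * (acmAlpha k y * (1 + q)) ^ 2 := by ring
    rw [e1, ha]
    linear_combination (-y) * hq2
  exact mul_right_cancel₀ (pow_ne_zero 2 hpos.ne') key

/-- **The Jacobian factor**: `1 - k α = √(1 - 2y'k)` on `1 - 2y'k > 0`.
[cite: AlbertiCrippaMazzucato2019, Lemma 23] -/
theorem one_sub_mul_acmAlpha {k y : ℝ} (h : 0 < 1 - 2 * y * k) :
    1 - k * acmAlpha k y = Real.sqrt (1 - 2 * y * k) := by
  set q := Real.sqrt (1 - 2 * y * k) with hq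
  have hq2 : q ^ 2 = 1 - 2 * y * k := Real.sq_sqrt h.le
  have hpos : 0 < 1 + q := one_add_sqrt_pos k y
  have ha : acmAlpha k y * (1 + q) = 2 * y := acmAlpha_mul_one_add_sqrt k y
  have key : (1 - k * acmAlpha k y) * (1 + q) = q * (1 + q) := by
    have e1 : (1 - k * acmAlpha k y) * (1 + q) = (1 + q) - k * (acmAlpha k y * (1 + q)) := by ring
    rw [e1, ha]
    linear_combination (-1 : ℝ) * hq2
  exact mul_right_cancel₀ hpos.ne' key

/-- **Derivative of `α` in the normal variable**: `∂_{y'} α(k, y') = (√(1 - 2y'k))⁻¹`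
(`= (1 - kα)⁻¹`) on `1 - 2y'k > 0`. [cite: AlbertiCrippaMazzucato2019, Lemma 23] -/
theorem hasDerivAt_acmAlpha {k y : ℝ} (h : 0 < 1 - 2 * y * k) :
    HasDerivAt (acmAlpha k) (Real.sqrt (1 - 2 * y * k))⁻¹ y := by
  set q := Real.sqrt (1 - 2 * y * k) with hq
  have hq0 : 0 < q := Real.sqrt_pos.2 h
  have hq2 : q ^ 2 = 1 - 2 * y * k := Real.sq_sqrt h.le
  -- derivative of the inner function and of the square root
  have hu : HasDerivAt (fun z => 1 - 2 * z * k) (-(2 * 1 * k)) y :=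
    HasDerivAt.const_sub 1 (HasDerivAt.mul_const (HasDerivAt.const_mul 2 (hasDerivAt_id' y)) k)
  have hsqrt : HasDerivAt (fun z => Real.sqrt (1 - 2 * z * k)) (-(2 * 1 * k) / (2 * q)) y :=
    HasDerivAt.sqrt hu h.ne'
  have hden : HasDerivAt (fun z => 1 + Real.sqrt (1 - 2 * z * k)) (-(2 * 1 * k) / (2 * q)) y :=
    HasDerivAt.const_add 1 hsqrt
  have hnum : HasDerivAt (fun z => 2 * z) (2 * 1) y := HasDerivAt.const_mul 2 (hasDerivAt_id' y)
  have hdiv := HasDerivAt.div hnum hden (one_add_sqrt_pos k y).ne'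
  have hpos : 0 < 1 + q := one_add_sqrt_pos k y
  have heq : (2 * 1 * (1 + Real.sqrt (1 - 2 * y * k)) - 2 * y * (-(2 * 1 * k) / (2 * q))) /
      (1 + Real.sqrt (1 - 2 * y * k)) ^ 2 = q⁻¹ := by
    rw [← hq, div_eq_iff (pow_ne_zero 2 hpos.ne')]
    have hN : 2 * 1 * (1 + q) - 2 * y * (-(2 * 1 * k) / (2 * q)) = 2 * (1 + q) + 2 * y * k / q := by
      field_simp
      ring
    rw [hN, show 2 * y * k = 1 - q ^ 2 by linarith [hq2]]
    field_simp
    ring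
  rw [heq] at hdiv
  exact hdiv

/-- `α` is jointly differentiable on `1 - 2y'k > 0`. [folklore] -/
theorem differentiableAt_acmAlpha_uncurry {k y : ℝ} (h : 0 < 1 - 2 * y * k) :
    DifferentiableAt ℝ (fun q : ℝ × ℝ => acmAlpha q.1 q.2) (k, y) := by
  have h1 : DifferentiableAt ℝ (fun q : ℝ × ℝ => 1 - 2 * q.2 * q.1) (k, y) := by fun_prop
  have h2 : DifferentiableAt ℝ (fun q : ℝ × ℝ => Real.sqrt (1 - 2 * q.2 * q.1)) (k, y) :=
    h1.sqrt (by simpa using h.ne')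
  have h3 : DifferentiableAt ℝ (fun q : ℝ × ℝ => 1 + Real.sqrt (1 - 2 * q.2 * q.1)) (k, y) :=
    (differentiableAt_const _).add h2
  have h0 : DifferentiableAt ℝ (fun q : ℝ × ℝ => 2 * q.2) (k, y) := by fun_prop
  have hne : (fun q : ℝ × ℝ => 1 + Real.sqrt (1 - 2 * q.2 * q.1)) (k, y) ≠ 0 := by
    simpa using (one_add_sqrt_pos k y).ne'
  have h4 := DifferentiableAt.mul h0 (DifferentiableAt.inv h3 hne)
  refine h4.congr_of_eventuallyEq (Filter.Eventually.of_forall fun q => ?_)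
  simp [acmAlpha, div_eq_mul_inv]

/-! ## The Jacobian identity -/

variable {E : Type*} [NormedAddCommGroup E] [InnerProductSpace ℝ E] [Fact (finrank ℝ E = 2)]
  (o : Orientation ℝ E (Fin 2))

/-- **Alberti–Crippa–Mazzucato 2019, Lemma 23 (the Jacobian identity).** Let `γ` be a plane
curve with `γ̇(s) = γ'(s)`, `γ̈(s) = γ''(s)`, speed `‖γ'(s)‖ = ℓ > 0` at `s`, and let `κ` be a
function with `κ(s) = ω(γ'(s), γ''(s))/ℓ³` (the signed curvature) which is differentiable at `s`.
Then at every `(s, y)` with `1 - 2(y/ℓ)κ(s) > 0` the map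
`Φ(s, y) = γ(s) + α(κ(s), y/ℓ) • ℓ⁻¹ J γ'(s)` (ACM (7.4)) is differentiable and area
preserving: its derivative `L` satisfies `ω(L(1,0), L(0,1)) = 1`.
[cite: AlbertiCrippaMazzucato2019, Lemma 23] -/
theorem areaForm_fderiv_tubularMap_eq_one {ℓ : ℝ} (hℓ : 0 < ℓ) {γ γ' γ'' : ℝ → E}
    {κ : ℝ → ℝ} {s y : ℝ} (hγ : HasDerivAt γ (γ' s) s) (hγ' : HasDerivAt γ' (γ'' s) s)
    (hspeed : ‖γ' s‖ = ℓ) (hκ : κ s = o.areaForm (γ' s) (γ'' s) / ℓ ^ 3)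
    (hκd : DifferentiableAt ℝ κ s) (hdom : 0 < 1 - 2 * (y / ℓ) * κ s) :
    ∃ L : ℝ × ℝ →L[ℝ] E,
      HasFDerivAt (fun p : ℝ × ℝ =>
        γ p.1 + acmAlpha (κ p.1) (p.2 / ℓ) • (ℓ⁻¹ • o.rightAngleRotation (γ' p.1))) L (s, y) ∧
      o.areaForm (L (1, 0)) (L (0, 1)) = 1 := by
  set Φ : ℝ × ℝ → E := fun p =>
    γ p.1 + acmAlpha (κ p.1) (p.2 / ℓ) • (ℓ⁻¹ • o.rightAngleRotation (γ' p.1)) with hΦ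
  set η : ℝ → E := fun t => ℓ⁻¹ • o.rightAngleRotation (γ' t) with hη
  set A : ℝ → ℝ := fun t => acmAlpha (κ t) (y / ℓ) with hA
  set q : ℝ := Real.sqrt (1 - 2 * (y / ℓ) * κ s) with hq
  have hq0 : 0 < q := Real.sqrt_pos.2 hdom
  have hJd : Differentiable ℝ (o.rightAngleRotation : E → E) :=
    o.rightAngleRotation.toContinuousLinearEquiv.toContinuousLinearMap.differentiable
  -- joint differentiability
  have hAd2 := differentiableAt_acmAlpha_uncurry hdom
  have hΦd : DifferentiableAt ℝ Φ (s, y) := by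
    have h1 : DifferentiableAt ℝ (fun p : ℝ × ℝ => γ p.1) (s, y) :=
      hγ.differentiableAt.comp _ differentiableAt_fst
    have h2 : DifferentiableAt ℝ (fun p : ℝ × ℝ => acmAlpha (κ p.1) (p.2 / ℓ)) (s, y) := by
      have hsnd : DifferentiableAt ℝ (fun p : ℝ × ℝ => p.2 / ℓ) (s, y) := by fun_prop
      have hin : DifferentiableAt ℝ (fun p : ℝ × ℝ => (κ p.1, p.2 / ℓ)) (s, y) :=
        (hκd.comp _ differentiableAt_fst).prodMk hsnd
      exact hAd2.comp (s, y) hin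
    have h3 : DifferentiableAt ℝ (fun p : ℝ × ℝ => ℓ⁻¹ • o.rightAngleRotation (γ' p.1)) (s, y) :=
      ((hJd _).comp _ (hγ'.differentiableAt.comp _ differentiableAt_fst)).const_smul _
    exact h1.add (h2.smul h3)
  refine ⟨fderiv ℝ Φ (s, y), hΦd.hasFDerivAt, ?_⟩
  -- the partial derivative in `y`
  have hy : HasDerivAt (Φ ∘ fun z : ℝ => ((s, z) : ℝ × ℝ)) ((q⁻¹ * ℓ⁻¹) • η s) y := by
    have h1 : HasDerivAt (fun z : ℝ => z * ℓ⁻¹) (1 * ℓ⁻¹) y :=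
      HasDerivAt.mul_const (hasDerivAt_id' y) ℓ⁻¹
    have hα : HasDerivAt (fun z => acmAlpha (κ s) (z * ℓ⁻¹)) (q⁻¹ * (1 * ℓ⁻¹)) y :=
      HasDerivAt.comp y (hasDerivAt_acmAlpha (by simpa [div_eq_mul_inv] using hdom)) h1
    have h3 : HasDerivAt (fun x => γ s + acmAlpha (κ s) (x * ℓ⁻¹) • η s)
        ((q⁻¹ * (1 * ℓ⁻¹)) • η s) y :=
      HasDerivAt.const_add (γ s) (HasDerivAt.smul_const hα (η s))
    rw [one_mul] at h3
    refine HasDerivAt.congr_of_eventuallyEq h3 (Filter.Eventually.of_forall fun z => ?_)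
    show Φ (s, z) = γ s + acmAlpha (κ s) (z * ℓ⁻¹) • η s
    simp only [hΦ, hη, div_eq_mul_inv]
  have hLy : fderiv ℝ Φ (s, y) (0, 1) = (q⁻¹ * ℓ⁻¹) • η s := by
    have hline : HasDerivAt (fun z : ℝ => ((s, z) : ℝ × ℝ)) ((0 : ℝ), (1 : ℝ)) y :=
      (hasDerivAt_const y s).prodMk (hasDerivAt_id y)
    have hc : HasDerivAt (Φ ∘ fun z : ℝ => ((s, z) : ℝ × ℝ)) (fderiv ℝ Φ (s, y) (0, 1)) y :=
      hΦd.hasFDerivAt.comp_hasDerivAt y hline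
    exact hc.unique hy
  -- the partial derivative in `s`
  have hηd : HasDerivAt η (ℓ⁻¹ • o.rightAngleRotation (γ'' s)) s :=
    HasDerivAt.const_smul ℓ⁻¹
      (o.rightAngleRotation.toContinuousLinearEquiv.toContinuousLinearMap.hasFDerivAt.comp_hasDerivAt
        s hγ')
  have hAd : DifferentiableAt ℝ A s := by
    have hin : DifferentiableAt ℝ (fun t => (κ t, y / ℓ)) s :=
      hκd.prodMk (differentiableAt_const _)
    exact DifferentiableAt.comp (g := fun q : ℝ × ℝ => acmAlpha q.1 q.2)
      (f := fun t => (κ t, y / ℓ)) s hAd2 hin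
  have hs' := HasDerivAt.add hγ (HasDerivAt.smul hAd.hasDerivAt hηd)
  have hs : HasDerivAt (Φ ∘ fun t : ℝ => ((t, y) : ℝ × ℝ))
      (γ' s + (A s • (ℓ⁻¹ • o.rightAngleRotation (γ'' s)) + deriv A s • η s)) s :=
    HasDerivAt.congr_of_eventuallyEq hs' (Filter.Eventually.of_forall fun t => rfl)
  have hLs : fderiv ℝ Φ (s, y) (1, 0) =
      γ' s + (A s • (ℓ⁻¹ • o.rightAngleRotation (γ'' s)) + deriv A s • η s) := by
    have hline : HasDerivAt (fun t : ℝ => ((t, y) : ℝ × ℝ)) ((1 : ℝ), (0 : ℝ)) s :=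
      (hasDerivAt_id s).prodMk (hasDerivAt_const s y)
    have hc : HasDerivAt (Φ ∘ fun t : ℝ => ((t, y) : ℝ × ℝ)) (fderiv ℝ Φ (s, y) (1, 0)) s :=
      hΦd.hasFDerivAt.comp_hasDerivAt s hline
    exact hc.unique hs
  -- the area form of the two partials
  have h1 : o.areaForm (γ' s) (η s) = ℓ := by
    simp only [hη, map_smul, Orientation.areaForm_rightAngleRotation_right,
      real_inner_self_eq_norm_sq, hspeed, smul_eq_mul]
    field_simp
  have h2 : o.areaForm (η s) (η s) = 0 := o.areaForm_apply_self _
  have h3 : o.areaForm (o.rightAngleRotation (γ'' s)) (η s) = -(ℓ ^ 2 * κ s) := by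
    simp only [hη, map_smul, Orientation.areaForm_comp_rightAngleRotation, smul_eq_mul]
    rw [o.areaForm_swap (γ'' s) (γ' s), hκ]
    field_simp
  have hval : o.areaForm (fderiv ℝ Φ (s, y) (1, 0)) (fderiv ℝ Φ (s, y) (0, 1)) =
      q⁻¹ * (1 - κ s * A s) := by
    rw [hLs, hLy]
    simp only [map_add, map_smul, LinearMap.add_apply, LinearMap.smul_apply, smul_eq_mul, h1, h2]
    rw [h3]
    field_simp
    ring
  rw [hval, one_sub_mul_acmAlpha hdom, ← hq, inv_mul_cancel₀ hq0.ne']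

end AlbertiCrippaMazzucato

end Literature.Analysis.FluidPDE

end
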